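import Mathlib

/-!
# SoloBlind — the constant-`K` Rayleigh identity, the pattern-scale Reynolds number,
# and the third-harmonic weight (kernel #132)

Paper §24.86 (NS-level audit of the closing step of the corner design).  At its own scale the
columnar pattern `U(z) = a cos(n z)` of the composite steady state is a Kolmogorov shear
profile at Reynolds number `Re_p = a n / K₀ → ∞`.  Three elementary facts used there:

* `rayleigh_constK_no_mode`: the real-number core of lemma (P).  For a profile with
  `-U'' = K (U - U_s)`, `K` constant, an unstable (or non-resonant neutral) Rayleigh mode `w`
  satisfies the identity `(K - k²) ∫|w|² - ∫|w'|² = J` with `J ≥ 0`; together with the Poincaré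
  inequality `λ₁ ∫|w|² ≤ ∫|w'|²` of the symmetry class and `K ≤ λ₁` this forces `∫|w|² = 0`.
  In the standing-pattern class (vertical velocity odd about the crest: Dirichlet on the half
  period) `λ₁ = n² = K`, so the cos profile has no unstable mode for any cross-leaf wavenumber
  `k > 0` (`cos_pattern_stable_oddClass`); `cos_profile_deriv1/2` record `-U'' = n² U`.
* `reynolds_at_marginal_scale`, `reynolds_pattern_unbounded`: a mode of wavenumber `k` with
  `ν k² = K₀` that dissipates at least `ε` has Reynolds number `≥ √(ε/K₀)·k/K₀` at its own
  scale, and `a n / K₀` is unbounded in `n`.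
* `third_harmonic_weight`: `∫₀^π (4 cos²θ - 3) sin²θ dθ = -π`, the first-order weight by which a
  slaved third harmonic of the profile moves the class eigenvalue `λ₁(-∂² - K)` (check (K3)).
-/

namespace Summit.AnomalousDissipation.AnomalousDissipation.Theorems

open Real intervalIntegral

/-- **Lemma (P), real-number core.**  `I0 = ∫|w|² ≥ 0`, `I1 = ∫|w'|²`, `J ≥ 0` the right side
of the constant-`K` Rayleigh identity `(K - k2)·I0 - I1 = J`, `k2 = k² > 0`, `lam1` the Poincaré
constant of the class (`lam1·I0 ≤ I1`).  If `K ≤ lam1` then `I0 = 0`: no mode. -/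
theorem rayleigh_constK_no_mode {I0 I1 J K k2 lam1 : ℝ}
    (hI0 : 0 ≤ I0) (hJ : 0 ≤ J) (hk : 0 < k2)
    (hid : (K - k2) * I0 - I1 = J) (hP : lam1 * I0 ≤ I1) (hK : K ≤ lam1) : I0 = 0 := by
  have h1 : k2 * I0 ≤ 0 := by nlinarith [mul_nonneg (sub_nonneg.mpr hK) hI0]
  have h2 : I0 ≤ 0 := by
    by_contra h
    exact absurd h1 (not_le.mpr (mul_pos hk (not_le.mp h)))
  exact le_antisymm h2 hI0

/-- **The cos pattern is Rayleigh-stable in the standing-pattern (odd) class.**  There the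
Poincaré constant is the Dirichlet one of the half period, `lam1 = n²`, and the profile constant
is `K = n²`; the identity then leaves no room for a mode at any `k² > 0`. -/
theorem cos_pattern_stable_oddClass {I0 I1 J n k2 : ℝ}
    (hI0 : 0 ≤ I0) (hJ : 0 ≤ J) (hk : 0 < k2)
    (hid : (n ^ 2 - k2) * I0 - I1 = J) (hP : n ^ 2 * I0 ≤ I1) : I0 = 0 :=
  rayleigh_constK_no_mode hI0 hJ hk hid hP le_rfl

/-- In the complementary (even, Neumann) class the Poincaré constant is `0`, and the sufficient
condition `K < lam1 + k²` of lemma (P) fails exactly on the long-wave band `k² < n²` — the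
Meshalkin–Sinai band of the Kolmogorov flow. -/
theorem evenClass_criterion_fails_iff {n k2 : ℝ} : ¬ (n ^ 2 < 0 + k2) ↔ k2 ≤ n ^ 2 := by
  rw [zero_add, not_lt]

/-- First derivative of the pattern profile `U(z) = a cos(n z)`. -/
theorem cos_profile_deriv1 (a n z : ℝ) :
    HasDerivAt (fun z : ℝ => a * Real.cos (n * z)) ((-(a * n)) * Real.sin (n * z)) z := by
  have h : HasDerivAt (fun z : ℝ => n * z) n z :=
    ((hasDerivAt_id z).const_mul n).congr_deriv (mul_one n)
  exact ((h.cos).const_mul a).congr_deriv (by ring)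

/-- Second derivative of the pattern profile: `U'' = -n² · U`, i.e. `-U'' = K (U - U_s)` with the
CONSTANT `K = n²` and `U_s = 0` — the hypothesis of lemma (P). -/
theorem cos_profile_deriv2 (a n z : ℝ) :
    HasDerivAt (fun z : ℝ => (-(a * n)) * Real.sin (n * z))
      (-(n ^ 2) * (a * Real.cos (n * z) - 0)) z := by
  have h : HasDerivAt (fun z : ℝ => n * z) n z :=
    ((hasDerivAt_id z).const_mul n).congr_deriv (mul_one n)
  exact ((h.sin).const_mul (-(a * n))).congr_deriv (by ring)

/-- **Reynolds number at a marginal dissipation-carrying scale.**  If a mode of wavenumber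
`k > 0` and amplitude `u ≥ 0` is viscously marginal, `ν k² = K₀`, and dissipates at least `ε`,
`ε ≤ ν k² u²`, then its Reynolds number `u/(k ν)` is at least `√(ε/K₀) · k / K₀` — which tends to
infinity with `k`.  (Paper §24.86(1)(b): every single-scale laminar realisation of the steady
door runs its pattern at `Re_p → ∞`.) -/
theorem reynolds_at_marginal_scale {ν k u ε K₀ : ℝ} (hν : 0 < ν) (hk : 0 < k) (hu : 0 ≤ u)
    (hK : ν * k ^ 2 = K₀) (hε : ε ≤ ν * k ^ 2 * u ^ 2) :
    Real.sqrt (ε / K₀) * k / K₀ ≤ u / (k * ν) := by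
  have hK0 : 0 < K₀ := by rw [← hK]; positivity
  have h1 : Real.sqrt (ε / K₀) ≤ u := by
    calc Real.sqrt (ε / K₀) ≤ Real.sqrt (u ^ 2) := by
          apply Real.sqrt_le_sqrt
          rw [div_le_iff₀ hK0]
          calc ε ≤ ν * k ^ 2 * u ^ 2 := hε
            _ = u ^ 2 * K₀ := by rw [← hK]; ring
      _ = u := Real.sqrt_sq hu
  have h2 : u / (k * ν) = u * (k / K₀) := by
    rw [← hK]; field_simp
  rw [h2, show Real.sqrt (ε / K₀) * k / K₀ = Real.sqrt (ε / K₀) * (k / K₀) by ring]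
  exact mul_le_mul_of_nonneg_right h1 (by positivity)

/-- The pattern-scale Reynolds number `Re_p(n) = a n / K₀` (fixed amplitude `a > 0`, fixed
`K₀ > 0`, `ν_n = K₀/n²`) is unbounded along `n`. -/
theorem reynolds_pattern_unbounded {a K₀ : ℝ} (ha : 0 < a) (hK : 0 < K₀) (M : ℝ) :
    ∃ n : ℕ, M < a * n / K₀ := by
  obtain ⟨n, hn⟩ := exists_nat_gt (M * K₀ / a)
  refine ⟨n, ?_⟩
  rw [lt_div_iff₀ hK]
  have := (div_lt_iff₀ ha).mp hn
  linarith

/-- **Third-harmonic weight (check (K3) of §24.86(3)(d)).**  The first-order shift of the class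
eigenvalue by a slaved third harmonic `ε₃ cos(3θ)` of the profile `cos θ` is governed by
`∫₀^π (cos 3θ / cos θ) sin²θ dθ = ∫₀^π (4cos²θ - 3) sin²θ dθ = -π`. -/
theorem third_harmonic_weight :
    ∫ θ in (0:ℝ)..π, (4 * Real.cos θ ^ 2 - 3) * Real.sin θ ^ 2 = -π := by
  have h1 : ∀ θ : ℝ, (4 * Real.cos θ ^ 2 - 3) * Real.sin θ ^ 2
      = 4 * (Real.sin θ ^ 2 * Real.cos θ ^ 2) - 3 * Real.sin θ ^ 2 := fun θ => by ring
  simp_rw [h1]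
  have hs4 : Real.sin (4 * π) = 0 := by
    have := Real.sin_nat_mul_pi 4
    push_cast at this
    exact this
  rw [intervalIntegral.integral_sub, intervalIntegral.integral_const_mul,
    intervalIntegral.integral_const_mul, integral_sin_sq_mul_cos_sq, integral_sin_sq]
  · simp only [sub_zero, mul_zero, Real.sin_zero, Real.cos_zero, Real.sin_pi, hs4, zero_mul,
      sub_self, zero_div, mul_one]
    ring
  · exact ((continuous_const.mul
      ((Real.continuous_sin.pow 2).mul (Real.continuous_cos.pow 2))).intervalIntegrable _ _)
  · exact ((continuous_const.mul (Real.continuous_sin.pow 2)).intervalIntegrable _ _)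

/-- `cos 3θ = (4cos²θ - 3)·cos θ` — the identity behind the weight above. -/
theorem cos_three_mul_factor (θ : ℝ) :
    Real.cos (3 * θ) = (4 * Real.cos θ ^ 2 - 3) * Real.cos θ := by
  rw [Real.cos_three_mul]; ring

end Summit.AnomalousDissipation.AnomalousDissipation.Theorems
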